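import Literature.NumberTheory.GaloisRepresentations.LubinTateComparisonAddPoints
import HarnessLib

/-!
# Values of `φ^{-k}((G ∘ H₁) ∘ H₂)` at a point: coefficient twists and coefficient extensions commute with substitution
# of `A`-series, and `((G ∘ H₁) ∘ H₂)(y) = G(H₁(H₂(y)))` (de Shalit I §2.2 / II §4.9 (ii) bookkeeping — proofs only)

Topic `NumberTheory/GaloisRepresentations`, namespace `Literature.NumberTheory.GaloisRepresentations.LubinTate` (theorems only; no
definition, no named fact, no instance).  In de Shalit's computation of the Coleman power series of the elliptic units (II §4.9 (ii):
«in the `t`-expansion of `φ^{-n}Q` … substitute `t = ω_n`») the series fed to the uniqueness statement of I §2.2 (tree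
`eq_relColemanSeries`: `evS (maxNilIdeal F (E ⊔ K_π^{m+1})) (ι ω_{m+1}) (map ι ((map φ⁻¹)^[m+1] g)) = β_m`) has the shape
`g = (Q ∘ H₁) ∘ H₂` with `Q ∈ 𝒪_E⟦X⟧` and `H₁, H₂ ∈ 𝒪_F⟦X⟧` WITHOUT constant term (`H₁ = [1]_{P,f}` the Lubin–Tate isomorphism onto the
curve's model, `H₂ = [a]_f` a unit of the Tate module; cell `bsd-print-cf2`, memo `B6-BRIDGE-II-VALUES-w4g13.md` §2–§3).  This file is the
generic algebra of that shape, over ring maps `algebraMap A S`, `σ : S →+* S` fixing `A` (the Frobenius twist `φ⁻¹` of the coefficients)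
and `ι : S →+* S'` over `A` (the inclusion `𝒪_E → 𝒪_{E·K_π^{m+1}}`):

* `map_subst_map_algebraMap_of_comp_eq` — `σ(G ∘ H) = σ(G) ∘ H`; `iterate_map_subst_map_algebraMap` — `σ^k(G ∘ H) = σ^k(G) ∘ H`;
  `map_subst_map_algebraMap_of_comp_eq'` — `ι(G ∘ H) = ι(G) ∘ H` (with `H` read over `S'`);
* `evS_subst_map_algebraMap` — **`(G ∘ H)(y) = G(H(y))`** at a point `y` of a closed nil ideal `M ⊆ S'` (`H(y) = evalPt₁ M H y`; tree
  `evS_subst`, `evS_map`);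
* ★ `evS_map_iterate_map_subst_subst` — the whole chain:
  **`(ι σ^k((G ∘ H₁) ∘ H₂))(y) = (ι σ^k G)(H₁(H₂(y)))`**.

Seat `bsd-line-cf2c-w4` g14; no summit statement is proved; BSD is not proved by any of this.

## References
* [deShalit1987] E. de Shalit, *Iwasawa theory of elliptic curves with complex multiplication* (1987), I §2.2 (13), II §4.5 (iv), II §4.9 (ii).
* [CasselsFrohlichANT1967] J.-P. Serre, *Local class field theory* (Cassels–Fröhlich Ch. VI), §3.2 (substitution of power series).
-/

noncomputable section

namespace Literature.NumberTheory.GaloisRepresentations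

namespace LubinTate

/-! ### Coefficient maps commute with substitution of an `A`-series -/

section Algebra

variable {A : Type*} [CommRing A] {S : Type*} [CommRing S] [Algebra A S] {S' : Type*} [CommRing S'] [Algebra A S']

/-- The coefficientwise image of a constant-term-free series is constant-term-free. [folklore] -/
private theorem constantCoeff_map_eq_zero_of {R T : Type*} [CommRing R] [CommRing T] (φ : R →+* T) {H : PowerSeries R}
    (hH : PowerSeries.constantCoeff H = 0) : PowerSeries.constantCoeff (H.map φ) = 0 := by
  rw [← PowerSeries.coeff_zero_eq_constantCoeff_apply, PowerSeries.coeff_map, PowerSeries.coeff_zero_eq_constantCoeff_apply, hH,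
    map_zero]

/-- **A coefficient twist fixing `A` commutes with substitution of an `A`-series**: for `σ : S →+* S` with `σ ∘ algebraMap = algebraMap`
and `H ∈ A⟦X⟧` without constant term, `σ(G ∘ H) = σ(G) ∘ H` — de Shalit's `(φ⁻¹ g) ∘ [a]_f = φ⁻¹(g ∘ [a]_f)` (the `[a]_f` have
coefficients in `𝒪_F`, fixed by `φ`). [cite: deShalit1987, II §4.5 (iv)] -/
theorem map_subst_map_algebraMap_of_comp_eq (σ : S →+* S) (hσ : σ.comp (algebraMap A S) = algebraMap A S)
    {H : PowerSeries A} (hH : PowerSeries.constantCoeff H = 0) (G : PowerSeries S) :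
    PowerSeries.map σ (PowerSeries.subst (H.map (algebraMap A S)) G) =
      PowerSeries.subst (H.map (algebraMap A S)) (PowerSeries.map σ G) := by
  have h := PowerSeries.map_subst
    (PowerSeries.HasSubst.of_constantCoeff_zero' (constantCoeff_map_eq_zero_of (algebraMap A S) hH)) (h := σ) G
  have h2 : MvPowerSeries.map σ (PowerSeries.map (algebraMap A S) H) = PowerSeries.map (algebraMap A S) H := by
    change ((PowerSeries.map σ).comp (PowerSeries.map (algebraMap A S))) H = _
    rw [← PowerSeries.map_comp, hσ]
  rw [h2] at h
  exact h

/-- Iterated form: `σ^k(G ∘ H) = σ^k(G) ∘ H`. [cite: deShalit1987, II §4.5 (iv)] -/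
theorem iterate_map_subst_map_algebraMap (σ : S →+* S) (hσ : σ.comp (algebraMap A S) = algebraMap A S)
    {H : PowerSeries A} (hH : PowerSeries.constantCoeff H = 0) (k : ℕ) (G : PowerSeries S) :
    (PowerSeries.map σ)^[k] (PowerSeries.subst (H.map (algebraMap A S)) G) =
      PowerSeries.subst (H.map (algebraMap A S)) ((PowerSeries.map σ)^[k] G) := by
  induction k generalizing G with
  | zero => rfl
  | succ k ih =>
    rw [Function.iterate_succ_apply, Function.iterate_succ_apply, ← ih]
    exact congrArg _ (map_subst_map_algebraMap_of_comp_eq σ hσ hH G)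

/-- **A coefficient extension over `A` commutes with substitution of an `A`-series**: for `ι : S →+* S'` with
`ι ∘ algebraMap A S = algebraMap A S'`, `ι(G ∘ H) = ι(G) ∘ H` (the second `H` read over `S'`). [cite: CasselsFrohlichANT1967, Ch. VI §3.2] -/
theorem map_subst_map_algebraMap_of_comp_eq' (ι : S →+* S') (hι : ι.comp (algebraMap A S) = algebraMap A S')
    {H : PowerSeries A} (hH : PowerSeries.constantCoeff H = 0) (G : PowerSeries S) :
    PowerSeries.map ι (PowerSeries.subst (H.map (algebraMap A S)) G) =
      PowerSeries.subst (H.map (algebraMap A S')) (PowerSeries.map ι G) := by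
  have h := PowerSeries.map_subst
    (PowerSeries.HasSubst.of_constantCoeff_zero' (constantCoeff_map_eq_zero_of (algebraMap A S) hH)) (h := ι) G
  have h2 : MvPowerSeries.map ι (PowerSeries.map (algebraMap A S) H) = PowerSeries.map (algebraMap A S') H := by
    change ((PowerSeries.map ι).comp (PowerSeries.map (algebraMap A S))) H = _
    rw [← PowerSeries.map_comp, hι]
  rw [h2] at h
  exact h

end Algebra

/-! ### Values at points -/

section Values

variable {A : Type*} [CommRing A] [UniformSpace A] [DiscreteUniformity A]
  {S : Type*} [CommRing S] [Algebra A S]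
  {S' : Type*} [CommRing S'] [UniformSpace S'] [IsUniformAddGroup S'] [IsTopologicalRing S'] [IsLinearTopology S' S'] [T2Space S']
  [CompleteSpace S'] [Algebra A S'] [ContinuousSMul A S'] (M : NilIdeal S')

/-- **`(G ∘ H)(y) = G(H(y))`** for `G ∈ S'⟦X⟧`, `H ∈ A⟦X⟧` without constant term and `y` a point of a closed nil ideal `M ⊆ S'`, where
`H(y) = evalPt₁ M H y` is the point-valued evaluation of the Lubin–Tate layer (tree `evS_subst` + `evS_map`).
[cite: deShalit1987, II §4.9 (ii)] [cite: CasselsFrohlichANT1967, Ch. VI §3.2] -/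
theorem evS_subst_map_algebraMap (y : M.toIdeal) {H : PowerSeries A} (hH : PowerSeries.constantCoeff H = 0) (G : PowerSeries S') :
    evS M y (PowerSeries.subst (H.map (algebraMap A S')) G) = evS M (evalPt₁ M H hH y) G := by
  have h0 : PowerSeries.constantCoeff (H.map (algebraMap A S')) = 0 := constantCoeff_map_eq_zero_of _ hH
  have hpt : (⟨evS M y (H.map (algebraMap A S')), evS_mem_of_constantCoeff_eq_zero M y h0⟩ : M.toIdeal) = evalPt₁ M H hH y :=
    Subtype.ext (coe_evalPt₁_eq_evS_map M H hH y).symm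
  rw [evS_subst M y h0, hpt]

/-- `((G ∘ H₁) ∘ H₂)(y) = G(H₁(H₂(y)))`. [cite: deShalit1987, II §4.9 (ii)] -/
theorem evS_subst_subst_map_algebraMap (y : M.toIdeal) {H₁ H₂ : PowerSeries A} (hH₁ : PowerSeries.constantCoeff H₁ = 0)
    (hH₂ : PowerSeries.constantCoeff H₂ = 0) (G : PowerSeries S') :
    evS M y (PowerSeries.subst (H₂.map (algebraMap A S')) (PowerSeries.subst (H₁.map (algebraMap A S')) G)) =
      evS M (evalPt₁ M H₁ hH₁ (evalPt₁ M H₂ hH₂ y)) G := by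
  rw [evS_subst_map_algebraMap M y hH₂, evS_subst_map_algebraMap M _ hH₁]

/-- ★ **The evaluation chain of de Shalit II §4.9 (ii) / I §2.2 (13)**: for `G ∈ S⟦X⟧`, `H₁, H₂ ∈ A⟦X⟧` without constant term, a
coefficient twist `σ : S →+* S` fixing `A` and a coefficient extension `ι : S →+* S'` over `A`,
**`(ι σ^k ((G ∘ H₁) ∘ H₂))(y) = (ι σ^k G)(H₁(H₂(y)))`** — with `G = Q` (the theta `t`-expansion), `H₁ = [1]_{P,f}`, `H₂ = [a]_f`, `σ = φ⁻¹`,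
`ι : 𝒪_E → 𝒪_{E·K_π^{m+1}}`, `y = ι ω_{m+1}` this is the left side of `eq_relColemanSeries` for `g = (Q ∘ h) ∘ [a]`, reduced to a value of
`φ^{-k}Q` at the torsion parameter `h([a] ω_{m+1})`. [cite: deShalit1987, I §2.2 (13), II §4.9 (ii)] -/
theorem evS_map_iterate_map_subst_subst (σ : S →+* S) (hσ : σ.comp (algebraMap A S) = algebraMap A S) (ι : S →+* S')
    (hι : ι.comp (algebraMap A S) = algebraMap A S') (y : M.toIdeal) {H₁ H₂ : PowerSeries A}
    (hH₁ : PowerSeries.constantCoeff H₁ = 0) (hH₂ : PowerSeries.constantCoeff H₂ = 0) (k : ℕ) (G : PowerSeries S) :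
    evS M y (PowerSeries.map ι ((PowerSeries.map σ)^[k]
        (PowerSeries.subst (H₂.map (algebraMap A S)) (PowerSeries.subst (H₁.map (algebraMap A S)) G)))) =
      evS M (evalPt₁ M H₁ hH₁ (evalPt₁ M H₂ hH₂ y)) (PowerSeries.map ι ((PowerSeries.map σ)^[k] G)) := by
  rw [iterate_map_subst_map_algebraMap σ hσ hH₂, iterate_map_subst_map_algebraMap σ hσ hH₁,
    map_subst_map_algebraMap_of_comp_eq' ι hι hH₂, map_subst_map_algebraMap_of_comp_eq' ι hι hH₁,
    evS_subst_subst_map_algebraMap M y hH₁ hH₂]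

/-- The one-substitution chain: **`(ι σ^k (G ∘ H))(y) = (ι σ^k G)(H(y))`**. [cite: deShalit1987, I §2.2 (13), II §4.5 (iv)] -/
theorem evS_map_iterate_map_subst (σ : S →+* S) (hσ : σ.comp (algebraMap A S) = algebraMap A S) (ι : S →+* S')
    (hι : ι.comp (algebraMap A S) = algebraMap A S') (y : M.toIdeal) {H : PowerSeries A}
    (hH : PowerSeries.constantCoeff H = 0) (k : ℕ) (G : PowerSeries S) :
    evS M y (PowerSeries.map ι ((PowerSeries.map σ)^[k] (PowerSeries.subst (H.map (algebraMap A S)) G))) =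
      evS M (evalPt₁ M H hH y) (PowerSeries.map ι ((PowerSeries.map σ)^[k] G)) := by
  rw [iterate_map_subst_map_algebraMap σ hσ hH, map_subst_map_algebraMap_of_comp_eq' ι hι hH, evS_subst_map_algebraMap M y hH]

end Values

end LubinTate

end Literature.NumberTheory.GaloisRepresentations

end
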